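import Mathlib
import HarnessLib
import Literature.Analysis.FluidPDE.ClassicalSolution
import Literature.Analysis.FluidPDE.ClassicalSolutionRescale
import Literature.Analysis.FluidPDE.ClassicalSolutionRegion
import Literature.Analysis.FluidPDE.ClassicalSuitableRegion
import Literature.Analysis.FluidPDE.LocalTypeI
import Literature.Analysis.FluidPDE.LocalTypeIBlowup.SingularVertexZoom
import Summits.NavierStokesRegularity.NavierStokesRegularity.Theorems.QuarterLogPincerTypeIQuantSubcubicExpZoomClass
import Summits.NavierStokesRegularity.NavierStokesRegularity.Theorems.QuarterLogPincerTypeIQuantSubcubicExpZoomBlowup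

/-!
# Crux `QuarterLogPincer.TypeIQuantSubcubicExp` (stmt-NavierStokesRegularity-24077), line `thin_cascade`:
  the zoom limit of cheap cascades has a BACKWARD SINGULAR POINT at the origin, GIVEN a uniform
  local Type-I bound of the zooms

Helper file (`--supports stmt-NavierStokesRegularity-24077 --as helper`, lead prover ns-tc-p1) toward the
registered stub `stub_thinObjectExtraction` (skeleton v5), part (3) «`SingularAt` of the zoom limit» of
the plan attached to the item (`S2-PLAN-v5-remaining.md`), steps 1, 3, 4 ASSEMBLED around the tree's
compactness-with-persistence engine `LocalTypeIBlowup.local_typeI_compactness_singular`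
(Albritton–Barker 2019 §3 + Barker–Prange 2020 Lemma 3): if the zooms `w_K` of a family of cheap
cascades converge pointwise on the open past along `φ` to `W` (the KNSS limit of
`exists_typeIAncientMild_zoomLimit_of_cheapCascades`) and their Albritton–Barker local Type-I bounds
`𝐈(Q(0,2ᵐ); w_{φ j}, q_{φ j}, ∇w_{φ j})`, `m ≤ j`, are bounded by one `I < ∞` — THE REMAINING INPUT,
to be supplied from the 4th stub `UniformScaledEnergy` on time-restricted frames (step 2, not here) —
then `W` has a backward singular point at the origin (`isBackwardSingularPoint_zoomLimit`), hence
`SingularAt W 0` by `singularAt_zero_of_isBackwardSingularPoint` (`…ZoomLimit`).  Ingredients: the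
zooms are in the class on `Q(0,2ᵐ)` (`zoom_isSuitableWeakSolutionInBall`, `…ZoomClass`) with the
classical weak gradient (`zoom_isClassicalNSSolutionOnRegion` here), they blow up on every `Q(0,R)`
along every subsequence (`limsup_eLpNorm_top_zoom_eq_top`, `…ZoomBlowup`), the engine's `L³_loc` limit
is singular at the origin, and it agrees a.e. with `W` on every `Q(0,R)` (an a.e.-convergent
sub-subsequence of an `L³`-convergent sequence, uniqueness of pointwise limits), which transfers the
essential unboundedness (`isBackwardSingularPoint_of_ae_eq`).

HONEST FRAMING: bookkeeping toward one registered stub of an open crux; conditional on the uniform bound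
`hbd` (an explicit hypothesis, no stub is assumed); nothing about Navier–Stokes regularity is proved; no
summit statement is proved by this file.
-/

noncomputable section

-- the summit-side namespace `Summit.NavierStokesRegularity.NavierStokesRegularity.…` (single-conjunct summit,
-- D-0017) repeats a component by design; the dupNamespace linter would flag every declaration.
set_option linter.dupNamespace false

namespace Summit.NavierStokesRegularity.NavierStokesRegularity.Theorems.ThinCascade

open MeasureTheory Set Function Filter Topology Metric
open scoped ENNReal NNReal
open Literature.Analysis Literature.Analysis.FluidPDE

/-- **The zoom of a cheap cascade is a classical solution on the region `Q(0, 2ᵐ)`, `m ≤ K`**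
(`4ᵐ ≤ e^{2m} ≤ e^{2K}`, backward life `e^{2K}ρ² ≤ T`). [folklore] -/
theorem zoom_isClassicalNSSolutionOnRegion {T ρ : ℝ} {K m : ℕ} (x₀ : EuclideanSpace ℝ (Fin 3))
    {u : ℝ → EuclideanSpace ℝ (Fin 3) → EuclideanSpace ℝ (Fin 3)}
    {p : ℝ → EuclideanSpace ℝ (Fin 3) → ℝ}
    (hcl₀ : IsClassicalNSSolutionOn (Icc 0 T) 1 0 u p)
    (hρ : 0 < ρ) (hlife : Real.exp (2 * K) * ρ ^ 2 ≤ T) (hm : m ≤ K) :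
    IsClassicalNSSolutionOnRegion (parabolicCylinder ((2 : ℝ) ^ m) (0 : ℝ × EuclideanSpace ℝ (Fin 3)))
      1 0 (ρ • stPull (ρ ^ 2) ρ T x₀ u) (ρ ^ 2 • stPull (ρ ^ 2) ρ T x₀ p) := by
  set R : ℝ := (2 : ℝ) ^ m with hR
  have hρ2 : 0 < ρ ^ 2 := by positivity
  set S : Set ℝ := (fun r => T + ρ ^ 2 * r) ⁻¹' Icc 0 T with hS
  have hcl : IsClassicalNSSolutionOn S 1 0 (ρ • stPull (ρ ^ 2) ρ T x₀ u)
      (ρ ^ 2 • stPull (ρ ^ 2) ρ T x₀ p) := hcl₀.nsRescale_translate_zero hρ T x₀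
  have hR2 : R ^ 2 ≤ Real.exp (2 * K) := by
    have e : R ^ 2 = (4 : ℝ) ^ m := by rw [hR, ← pow_mul, mul_comm, pow_mul]; norm_num
    rw [e]
    refine (four_pow_le_exp_two_mul m).trans (Real.exp_le_exp.2 ?_)
    exact_mod_cast Nat.mul_le_mul_left 2 hm
  have hIcc : Icc (-R ^ 2) 0 ⊆ S := by
    intro s hs
    rw [hS, mem_preimage, mem_Icc]
    refine ⟨?_, by nlinarith [hs.2]⟩
    have h1 : ρ ^ 2 * (-R ^ 2) ≤ ρ ^ 2 * s := mul_le_mul_of_nonneg_left hs.1 hρ2.le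
    have h2 : ρ ^ 2 * R ^ 2 ≤ T := le_trans (by nlinarith) hlife
    nlinarith
  have hQS : parabolicCylinder R (0 : ℝ × EuclideanSpace ℝ (Fin 3)) ⊆ S ×ˢ univ := by
    intro z hz
    rw [mem_parabolicCylinder] at hz
    obtain ⟨⟨h1, h2⟩, -⟩ := hz
    simp only [Prod.fst_zero, zero_sub] at h1 h2
    exact ⟨hIcc ⟨h1.le, h2.le⟩, mem_univ _⟩
  have h := hcl.onRegion_inter (isOpen_parabolicCylinder R (0 : ℝ × EuclideanSpace ℝ (Fin 3)))
  rwa [inter_eq_right.2 hQS] at h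

/-- Monotonicity of backward parabolic cylinders in the radius. [folklore] -/
theorem parabolicCylinder_mono_radius {r R : ℝ} (h : r ≤ R) (hr : 0 ≤ r)
    (z : ℝ × EuclideanSpace ℝ (Fin 3)) :
    parabolicCylinder r z ⊆ parabolicCylinder R z := by
  intro w hw
  rw [mem_parabolicCylinder] at hw ⊢
  obtain ⟨⟨h1, h2⟩, h3⟩ := hw
  exact ⟨⟨by nlinarith [mul_le_mul h h hr (hr.trans h)], h2⟩, h3.trans_le h⟩

/-- **A backward singular point passes along a.e. equality on every backward cylinder** (the notion
is an essential supremum). [folklore] -/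
theorem isBackwardSingularPoint_of_ae_eq
    {u W : ℝ → EuclideanSpace ℝ (Fin 3) → EuclideanSpace ℝ (Fin 3)}
    (hae : ∀ R : ℝ, 0 < R → uncurry u =ᵐ[volume.restrict
      (parabolicCylinder R (0 : ℝ × EuclideanSpace ℝ (Fin 3)))] uncurry W)
    (hu : IsBackwardSingularPoint u 0) : IsBackwardSingularPoint W 0 := by
  intro r hr
  rw [← eLpNorm_congr_ae (hae r hr)]
  exact hu r hr

/-- **The zoom limit of cheap cascades has a backward singular point at the origin, given a uniform
local Type-I bound of the zooms.**  Let `(T_K, ρ_K, x₀^K, u_K, p_K)` be cheap-cascade witnesses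
(classical on `[0,T_K]`, `e^{2K}ρ_K² ≤ T_K`, `ρ_K‖u_K(T_K,x₀^K)‖ ≥ e^K`), let the zooms
`w_K = ρ_K • stPull (ρ_K²) ρ_K T_K x₀^K u_K` converge pointwise on the open past along a strictly
increasing `φ` to `W`, and suppose `𝐈(Q(0,2ᵐ); w_{φ j}, q_{φ j}, ∇w_{φ j}) ≤ I < ∞` for `m ≤ j`.  Then
`W` has a backward singular point at `(0,0)`. [folklore] -/
theorem isBackwardSingularPoint_zoomLimit {T ρ : ℕ → ℝ} {x₀ : ℕ → EuclideanSpace ℝ (Fin 3)}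
    {u : ℕ → ℝ → EuclideanSpace ℝ (Fin 3) → EuclideanSpace ℝ (Fin 3)}
    {p : ℕ → ℝ → EuclideanSpace ℝ (Fin 3) → ℝ}
    (hcl : ∀ K, IsClassicalNSSolutionOn (Icc 0 (T K)) 1 0 (u K) (p K)) (hρ : ∀ K, 0 < ρ K)
    (hlife : ∀ K : ℕ, Real.exp (2 * K) * ρ K ^ 2 ≤ T K)
    (hcentre : ∀ K : ℕ, Real.exp K ≤ ρ K * ‖u K (T K) (x₀ K)‖)
    {φ : ℕ → ℕ} (hφ : StrictMono φ)
    {W : ℝ → EuclideanSpace ℝ (Fin 3) → EuclideanSpace ℝ (Fin 3)}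
    (hpt : ∀ t < 0, ∀ x, Tendsto
      (fun j => ((ρ (φ j)) • stPull (ρ (φ j) ^ 2) (ρ (φ j)) (T (φ j)) (x₀ (φ j)) (u (φ j))) t x)
      atTop (𝓝 (W t x)))
    {I : ℝ≥0∞} (hI : I < ⊤)
    (hbd : ∀ m j : ℕ, m ≤ j →
      typeIBound (parabolicCylinder ((2 : ℝ) ^ m) (0 : ℝ × EuclideanSpace ℝ (Fin 3)))
        ((ρ (φ j)) • stPull (ρ (φ j) ^ 2) (ρ (φ j)) (T (φ j)) (x₀ (φ j)) (u (φ j)))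
        ((ρ (φ j)) ^ 2 • stPull (ρ (φ j) ^ 2) (ρ (φ j)) (T (φ j)) (x₀ (φ j)) (p (φ j)))
        (fun t x => fderiv ℝ
          (((ρ (φ j)) • stPull (ρ (φ j) ^ 2) (ρ (φ j)) (T (φ j)) (x₀ (φ j)) (u (φ j))) t) x) ≤ I) :
    IsBackwardSingularPoint W 0 := by
  -- the sequence fed to the engine
  set v : ℕ → ℝ → EuclideanSpace ℝ (Fin 3) → EuclideanSpace ℝ (Fin 3) :=
    fun j => (ρ (φ j)) • stPull (ρ (φ j) ^ 2) (ρ (φ j)) (T (φ j)) (x₀ (φ j)) (u (φ j)) with hv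
  set q : ℕ → ℝ → EuclideanSpace ℝ (Fin 3) → ℝ :=
    fun j => (ρ (φ j)) ^ 2 • stPull (ρ (φ j) ^ 2) (ρ (φ j)) (T (φ j)) (x₀ (φ j)) (p (φ j)) with hq
  set G : ℕ → ℝ → EuclideanSpace ℝ (Fin 3) →
      EuclideanSpace ℝ (Fin 3) →L[ℝ] EuclideanSpace ℝ (Fin 3) :=
    fun j t x => fderiv ℝ (v j t) x with hG
  have hmφ : ∀ m j : ℕ, m ≤ j → m ≤ φ j := fun m j h => h.trans (hφ.id_le j)
  have hreg : ∀ m j : ℕ, m ≤ j → IsClassicalNSSolutionOnRegion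
      (parabolicCylinder ((2 : ℝ) ^ m) (0 : ℝ × EuclideanSpace ℝ (Fin 3))) 1 0 (v j) (q j) :=
    fun m j h => zoom_isClassicalNSSolutionOnRegion (x₀ (φ j)) (hcl _) (hρ _) (hlife _) (hmφ m j h)
  have hball : ∀ m j : ℕ, m ≤ j → IsSuitableWeakSolutionInBall ((2 : ℝ) ^ m) 0 (v j) (q j) :=
    fun m j h => zoom_isSuitableWeakSolutionInBall (x₀ (φ j)) (hcl _) (hρ _) (hlife _) (hmφ m j h)
  have hwg : ∀ m j : ℕ, m ≤ j → HasWeakSpatialGradientOn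
      (parabolicCylinderOpens ((2 : ℝ) ^ m) (0 : ℝ × EuclideanSpace ℝ (Fin 3))) (v j) (G j) :=
    fun m j h => (hreg m j h).hasWeakSpatialGradientOn (isOpen_parabolicCylinder _ _) subset_rfl
  obtain ⟨U, P, H, σ, hσ, -, -, -, hL3, hconv, hsing⟩ :=
    LocalTypeIBlowup.local_typeI_compactness_singular I v q G hI hball hwg hbd
  -- the engine's limit is singular at the origin: the zooms blow up along `φ ∘ σ`
  have hUsing : IsBackwardSingularPoint U 0 :=
    hsing fun R hR => limsup_eLpNorm_top_zoom_eq_top hcl hρ hlife hcentre (hφ.comp hσ) hR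
  -- the engine's limit agrees a.e. with `W` on every `Q(0, R)`
  refine isBackwardSingularPoint_of_ae_eq (fun R hR => ?_) hUsing
  set Q : Set (ℝ × EuclideanSpace ℝ (Fin 3)) :=
    parabolicCylinder R (0 : ℝ × EuclideanSpace ℝ (Fin 3)) with hQ
  have hQmeas : MeasurableSet Q := (isOpen_parabolicCylinder _ _).measurableSet
  -- a level `m₀` with `R ≤ 2^{m₀}`: from `m₀` on, the zooms are continuous on `Q`
  obtain ⟨m₀, hm₀⟩ := pow_unbounded_of_one_lt R (by norm_num : (1 : ℝ) < 2)
  have hQsub : Q ⊆ parabolicCylinder ((2 : ℝ) ^ m₀) (0 : ℝ × EuclideanSpace ℝ (Fin 3)) :=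
    parabolicCylinder_mono_radius hm₀.le hR.le _
  have hmeas : ∀ n : ℕ, AEStronglyMeasurable (uncurry (v (σ (n + m₀)))) (volume.restrict Q) := by
    intro n
    have hle : m₀ ≤ σ (n + m₀) := (Nat.le_add_left m₀ n).trans (hσ.id_le _)
    exact ((hreg m₀ _ hle).smooth_velocity.continuousOn.mono hQsub).aestronglyMeasurable hQmeas
  have hUmeas : AEStronglyMeasurable (uncurry U) (volume.restrict Q) := (hL3 R hR).aestronglyMeasurable
  have hconv' : Tendsto (fun n => eLpNorm (uncurry (v (σ (n + m₀))) - uncurry U) 3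
      (volume.restrict Q)) atTop (𝓝 0) :=
    (hconv R hR).comp (tendsto_add_atTop_nat m₀)
  obtain ⟨ns, hns, hae⟩ :=
    (tendstoInMeasure_of_tendsto_eLpNorm (by norm_num) hmeas hUmeas hconv').exists_seq_tendsto_ae
  -- along `j ↦ σ (ns i + m₀)` the zooms converge pointwise to `W` on `Q` (negative times)
  have hidx : Tendsto (fun i => σ (ns i + m₀)) atTop atTop :=
    hσ.tendsto_atTop.comp ((tendsto_add_atTop_nat m₀).comp hns.tendsto_atTop)
  filter_upwards [hae, ae_restrict_mem hQmeas] with z h1 h2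
  have ht : z.1 < 0 := by
    rw [hQ, mem_parabolicCylinder] at h2
    simpa using h2.1.2
  have h3 : Tendsto (fun i => uncurry (v (σ (ns i + m₀))) z) atTop (𝓝 (uncurry W z)) :=
    (hpt z.1 ht z.2).comp hidx
  exact tendsto_nhds_unique h1 h3

end Summit.NavierStokesRegularity.NavierStokesRegularity.Theorems.ThinCascade

end
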